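import Mathlib
import HarnessLib
import Literature.Analysis.FluidPDE.SelfSimilar
import Literature.Analysis.FluidPDE.VectorCalculusProofs
import Literature.Analysis.FluidPDE.AxisymHouLiVariables
import Literature.Analysis.FluidPDE.TaoEnstrophyLocalisation
import Summits.NavierStokesRegularity.NavierStokesRegularity.Theorems.HalfSpaceWindowDoorCirculationCarryingRigidityPlaneFlux
import Summits.NavierStokesRegularity.NavierStokesRegularity.Theorems.HalfSpaceWindowDoorCirculationCarryingRigidityTiltingFlux
import Summits.NavierStokesRegularity.NavierStokesRegularity.Theorems.ChiralWindowDoorClassDerivDecay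
import Summits.NavierStokesRegularity.NavierStokesRegularity.Theorems.RellichScarScarRigidityVorticityDefectIBP

/-!
# Route `HalfSpaceWindowDoor`, crux `CirculationCarryingRigidity` (stmt-NavierStokesRegularity-25311) — the HEIGHT DERIVATIVE
# of the Gaussian-windowed plane flux (lemmas for `…PlaneFluxHeight`: plane circulation is independent of the height)

For a `C²` field `V` on `ℝ³` with bounded vorticity `‖curl V‖ ≤ B₁` and bounded vorticity gradient `‖D(curl V)‖ ≤ M₂`, the centred
windowed plane flux `Ψ_L(c) = ∫ ⟪curl V(y,c), e₃⟫ g_{L,0}(y) dy` (g0's `gaussWin`, `planePt`) is differentiable in the height `c`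
with

  `Ψ_L′(c) = Σ_{j=0,1} ∫ (curl V(y,c))ⱼ ∂ⱼ g_{L,0}(y) dy`   (`hasDerivAt_windowedFlux_height`)

— differentiate under the integral (dominated by `M₂ g_{L,0}`), use `div curl V = 0` in the form `∂₃ω₃ = −∂₀ω₀ − ∂₁ω₁`
(`divergence_curl_eq_zero_holds`, `divergence_eq_sum_three`) and integrate by parts in the plane (g0's
`…TiltingFlux.integral_fderiv_planePt_mul_gaussWin`).  Under the vorticity DECAY `‖curl V(x)‖(‖x‖+ρ)² ≤ A` this derivative is
small for wide windows: `|Ψ_L′(c)| ≤ (A/L²)·J(L)`, `J(L) = ∫ g_{L,0}/(‖y‖+ρ) ≤ 1/R + eR²/(4ρL²)` for every `R > 0`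
(`integral_gaussWin_div_le`, via `1/(‖y‖+ρ) ≤ 1/R + ρ⁻¹e^{1−‖y‖²/R²}` and the Gaussian product
`g_{L,0} e^{−‖y‖²/R²} = (R²/(R²+4L²)) g_{L′,0}`), whence the Lipschitz bound
`|4πL²Ψ_L(c₂) − 4πL²Ψ_L(c₁)| ≤ 4πA(1/R + eR²/(4ρL²))|c₂ − c₁|` (`abs_sub_windowedFlux_le`, mean value theorem).

Seat ns-hsw-p1 g2 (LEAD of 25311, cell pub-ns-dss).  WHAT THIS IS NOT: not a statement about Navier–Stokes regularity;
calculus lemmas about windowed plane integrals of HYPOTHETICAL blow-up profiles; helper `--supports` 25311.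
-/

noncomputable section

-- the summit and its single sub-problem share the name (CONVENTIONS §1), as in every Theorems file
set_option linter.dupNamespace false

namespace Summit.NavierStokesRegularity.NavierStokesRegularity.Theorems.HalfSpaceWindowDoorCirculationCarryingRigidityPlaneFluxHeightWindow

open MeasureTheory Set Function Filter Topology Metric
open scoped RealInnerProductSpace InnerProductSpace ENNReal
open Literature.Analysis Literature.Analysis.FluidPDE Literature.Analysis.UnboundedOperators
open Summit.NavierStokesRegularity.NavierStokesRegularity.Theorems.HalfSpaceWindowDoorCirculationCarryingRigidityDefs
open Summit.NavierStokesRegularity.NavierStokesRegularity.Theorems.HalfSpaceWindowDoorCirculationCarryingRigidityWindowedFlux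
  (gaussWin_pos continuous_gaussWin integrable_gaussWin continuous_planePt)
open Summit.NavierStokesRegularity.NavierStokesRegularity.Theorems.HalfSpaceWindowDoorCirculationCarryingRigidityPlaneFlux
  (norm_le_norm_planePt abs_fderiv_gaussWin_zero_apply_le integral_gaussWin_zero abs_integral_inner_curl_e3_mul_gaussWin_le_of_decay
    planeFlux_le_of_decay)
open Summit.NavierStokesRegularity.NavierStokesRegularity.Theorems.HalfSpaceWindowDoorCirculationCarryingRigidityTiltingFlux
  (integral_fderiv_planePt_mul_gaussWin)
open Summit.NavierStokesRegularity.NavierStokesRegularity.Theorems.LocalSineTubeDoorProfileAlignedWindowRigidityAncient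
  (bdd_of_hasTypeITimeDecay analyticOnNhd_slice)
open Summit.NavierStokesRegularity.NavierStokesRegularity.Theorems.PoloidalWindowDoorPoloidalWindowRigidityClassSpaceTimeRates
  (exists_fderiv_rate_of_class' exists_iteratedFDeriv_two_rate_of_class')
open Summit.NavierStokesRegularity.NavierStokesRegularity.Theorems.ChiralWindowDoorClassDerivDecay (derivDecay_of_class)
open Summit.NavierStokesRegularity.NavierStokesRegularity.Theorems.RellichScarScarRigidity (norm_fderiv_coord_le_opNorm)

/-! ### Small plane / frame lemmas -/

/-- `⟪a, e₃⟫ = a₂`. -/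
theorem inner_e3_eq_apply (a : EuclideanSpace ℝ (Fin 3)) : ⟪a, e3⟫ = a 2 := by
  rw [e3, EuclideanSpace.inner_single_right]
  simp

/-- `|⟪a, e₃⟫| ≤ ‖a‖`. -/
theorem abs_inner_e3_le (a : EuclideanSpace ℝ (Fin 3)) : |⟪a, e3⟫| ≤ ‖a‖ := by
  have h := abs_real_inner_le_norm a e3
  have hn : ‖e3‖ = 1 := by rw [e3, PiLp.norm_single, norm_one]
  rwa [hn, mul_one] at h

/-- The plane chart is affine in the height: `d/dc (y₀,y₁,c) = e₃`. -/
theorem hasDerivAt_planePt_height (c : ℝ) (y : EuclideanSpace ℝ (Fin 2)) :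
    HasDerivAt (fun c : ℝ => planePt c y) e3 c := by
  have hfun : (fun c : ℝ => planePt c y) = fun c : ℝ =>
      ((y 0) • EuclideanSpace.single 0 1 + (y 1) • EuclideanSpace.single 1 1) + c • EuclideanSpace.single 2 (1 : ℝ) := by
    funext c
    rw [Summit.NavierStokesRegularity.NavierStokesRegularity.Theorems.HalfSpaceWindowDoorCirculationCarryingRigidityWindowedFlux.planePt_eq_sum]
  rw [hfun, e3]
  have h := ((hasDerivAt_id c).smul_const (EuclideanSpace.single (2 : Fin 3) (1 : ℝ))).const_add
    ((y 0) • EuclideanSpace.single 0 1 + (y 1) • EuclideanSpace.single 1 1)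
  simpa using h

/-- Coordinate derivative: `D(Wᵢ)(x) h = (DW(x) h)ᵢ`. -/
theorem fderiv_coord_apply {W : EuclideanSpace ℝ (Fin 3) → EuclideanSpace ℝ (Fin 3)} {x : EuclideanSpace ℝ (Fin 3)}
    (hW : DifferentiableAt ℝ W x) (i : Fin 3) (h : EuclideanSpace ℝ (Fin 3)) :
    fderiv ℝ (fun z => W z i) x h = fderiv ℝ W x h i := by
  have hc := (EuclideanSpace.proj (𝕜 := ℝ) i).hasFDerivAt.comp x hW.hasFDerivAt
  have hfun : (fun z => W z i) = (EuclideanSpace.proj (𝕜 := ℝ) i) ∘ W := rfl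
  rw [hfun, hc.fderiv, ContinuousLinearMap.comp_apply]
  rfl

/-- The curl of a `C²` field is `C¹`. -/
theorem contDiff_one_curl {V : EuclideanSpace ℝ (Fin 3) → EuclideanSpace ℝ (Fin 3)} (hV : ContDiff ℝ 2 V) :
    ContDiff ℝ 1 (curl V) := by
  rw [curl_eq_curlCLM_comp]
  exact curlCLM.contDiff.comp (hV.fderiv_right le_rfl)

/-- `1/(‖y‖+ρ) ≤ 1/R + ρ⁻¹ e^{1 − ‖y‖²/R²}` (split at `‖y‖ = R`). -/
theorem inv_norm_add_le {ρ R : ℝ} (hρ : 0 < ρ) (hR : 0 < R) (y : EuclideanSpace ℝ (Fin 2)) :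
    1 / (‖y‖ + ρ) ≤ 1 / R + ρ⁻¹ * Real.exp (1 - ‖y‖ ^ 2 / R ^ 2) := by
  have hpos : 0 < ‖y‖ + ρ := by positivity
  by_cases hy : R ≤ ‖y‖
  · have h1 : 1 / (‖y‖ + ρ) ≤ 1 / R := one_div_le_one_div_of_le hR (by linarith)
    have h2 : 0 ≤ ρ⁻¹ * Real.exp (1 - ‖y‖ ^ 2 / R ^ 2) := by positivity
    linarith
  · push Not at hy
    have h1 : 1 / (‖y‖ + ρ) ≤ ρ⁻¹ := by
      rw [one_div]
      exact inv_anti₀ hρ (by linarith [norm_nonneg y])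
    have hexp : 1 ≤ Real.exp (1 - ‖y‖ ^ 2 / R ^ 2) := by
      apply Real.one_le_exp
      have : ‖y‖ ^ 2 / R ^ 2 ≤ 1 := by
        rw [div_le_one (by positivity)]
        exact pow_le_pow_left₀ (norm_nonneg _) hy.le 2
      linarith
    have h2 : ρ⁻¹ ≤ ρ⁻¹ * Real.exp (1 - ‖y‖ ^ 2 / R ^ 2) := le_mul_of_one_le_right (by positivity) hexp
    have h3 : 0 ≤ 1 / R := by positivity
    linarith

/-- **Gaussian moment bound**: `∫ g_{L,0}(y) e^{−‖y‖²/R²} dy ≤ R²/(4L²)` (the product is `(L′²/L²) g_{L′,0}` with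
`L′² = L²R²/(R²+4L²)`, and `∫ g_{L′,0} = 1`). -/
theorem integral_gaussWin_mul_exp_le {L R : ℝ} (hL : 0 < L) (hR : 0 < R) :
    Integrable (fun y : EuclideanSpace ℝ (Fin 2) => gaussWin L 0 y * Real.exp (-‖y‖ ^ 2 / R ^ 2)) ∧
      ∫ y : EuclideanSpace ℝ (Fin 2), gaussWin L 0 y * Real.exp (-‖y‖ ^ 2 / R ^ 2) ≤ R ^ 2 / (4 * L ^ 2) := by
  set L' : ℝ := Real.sqrt (L ^ 2 * R ^ 2 / (R ^ 2 + 4 * L ^ 2)) with hL'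
  have hden : 0 < R ^ 2 + 4 * L ^ 2 := by positivity
  have hL'2 : L' ^ 2 = L ^ 2 * R ^ 2 / (R ^ 2 + 4 * L ^ 2) := Real.sq_sqrt (by positivity)
  have hL'pos : 0 < L' := Real.sqrt_pos.2 (by positivity)
  have hfac : ∀ y : EuclideanSpace ℝ (Fin 2), gaussWin L 0 y * Real.exp (-‖y‖ ^ 2 / R ^ 2) =
      (R ^ 2 / (R ^ 2 + 4 * L ^ 2)) * gaussWin L' 0 y := by
    intro y
    simp only [gaussWin, sub_zero]
    rw [hL'2, div_mul_eq_mul_div, ← Real.exp_add]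
    have h1 : -‖y‖ ^ 2 / (4 * L ^ 2) + -‖y‖ ^ 2 / R ^ 2 = -‖y‖ ^ 2 / (4 * (L ^ 2 * R ^ 2 / (R ^ 2 + 4 * L ^ 2))) := by
      field_simp
      ring
    rw [h1]
    field_simp
  have hint : Integrable (fun y : EuclideanSpace ℝ (Fin 2) => gaussWin L 0 y * Real.exp (-‖y‖ ^ 2 / R ^ 2)) := by
    have h := (integrable_gaussWin hL'pos 0).const_mul (R ^ 2 / (R ^ 2 + 4 * L ^ 2))
    exact h.congr (ae_of_all _ fun y => (hfac y).symm)
  refine ⟨hint, ?_⟩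
  calc ∫ y : EuclideanSpace ℝ (Fin 2), gaussWin L 0 y * Real.exp (-‖y‖ ^ 2 / R ^ 2)
      = ∫ y : EuclideanSpace ℝ (Fin 2), (R ^ 2 / (R ^ 2 + 4 * L ^ 2)) * gaussWin L' 0 y := integral_congr_ae (ae_of_all _ hfac)
    _ = R ^ 2 / (R ^ 2 + 4 * L ^ 2) := by rw [integral_const_mul, integral_gaussWin_zero hL'pos, mul_one]
    _ ≤ R ^ 2 / (4 * L ^ 2) := div_le_div_of_nonneg_left (sq_nonneg R) (by positivity) (by linarith [sq_nonneg R])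

/-- **`J(L) = ∫ g_{L,0}(y)/(‖y‖+ρ) dy ≤ 1/R + e R²/(4ρL²)`** for all `L, R, ρ > 0`. -/
theorem integral_gaussWin_div_le {L R ρ : ℝ} (hL : 0 < L) (hR : 0 < R) (hρ : 0 < ρ) :
    Integrable (fun y : EuclideanSpace ℝ (Fin 2) => gaussWin L 0 y / (‖y‖ + ρ)) ∧
      ∫ y : EuclideanSpace ℝ (Fin 2), gaussWin L 0 y / (‖y‖ + ρ) ≤ 1 / R + Real.exp 1 * R ^ 2 / (4 * ρ * L ^ 2) := by
  have hgi := integrable_gaussWin hL (0 : EuclideanSpace ℝ (Fin 2))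
  have hcont : Continuous fun y : EuclideanSpace ℝ (Fin 2) => gaussWin L 0 y / (‖y‖ + ρ) :=
    (continuous_gaussWin L 0).div (continuous_norm.add continuous_const) fun y => by positivity
  have hint : Integrable (fun y : EuclideanSpace ℝ (Fin 2) => gaussWin L 0 y / (‖y‖ + ρ)) := by
    refine Integrable.mono' (hgi.const_mul ρ⁻¹) hcont.aestronglyMeasurable (ae_of_all _ fun y => ?_)
    have hg0 : 0 ≤ gaussWin L 0 y := (gaussWin_pos hL 0 y).le
    rw [Real.norm_eq_abs, abs_of_nonneg (by positivity)]
    calc gaussWin L 0 y / (‖y‖ + ρ) ≤ gaussWin L 0 y / ρ :=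
          div_le_div_of_nonneg_left hg0 hρ (by linarith [norm_nonneg y])
      _ = ρ⁻¹ * gaussWin L 0 y := by rw [div_eq_mul_inv, mul_comm]
  obtain ⟨hint2, hle2⟩ := integral_gaussWin_mul_exp_le hL hR
  refine ⟨hint, ?_⟩
  have hpt : ∀ y : EuclideanSpace ℝ (Fin 2), gaussWin L 0 y / (‖y‖ + ρ) ≤
      (1 / R) * gaussWin L 0 y + (Real.exp 1 * ρ⁻¹) * (gaussWin L 0 y * Real.exp (-‖y‖ ^ 2 / R ^ 2)) := by
    intro y
    have hg0 : 0 ≤ gaussWin L 0 y := (gaussWin_pos hL 0 y).le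
    have h := mul_le_mul_of_nonneg_left (inv_norm_add_le hρ hR y) hg0
    have hexp : Real.exp (1 - ‖y‖ ^ 2 / R ^ 2) = Real.exp 1 * Real.exp (-‖y‖ ^ 2 / R ^ 2) := by
      rw [← Real.exp_add]; ring_nf
    calc gaussWin L 0 y / (‖y‖ + ρ) = gaussWin L 0 y * (1 / (‖y‖ + ρ)) := by ring
      _ ≤ gaussWin L 0 y * (1 / R + ρ⁻¹ * Real.exp (1 - ‖y‖ ^ 2 / R ^ 2)) := h
      _ = (1 / R) * gaussWin L 0 y + (Real.exp 1 * ρ⁻¹) * (gaussWin L 0 y * Real.exp (-‖y‖ ^ 2 / R ^ 2)) := by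
          rw [hexp]; ring
  have hrhs : Integrable (fun y : EuclideanSpace ℝ (Fin 2) =>
      (1 / R) * gaussWin L 0 y + (Real.exp 1 * ρ⁻¹) * (gaussWin L 0 y * Real.exp (-‖y‖ ^ 2 / R ^ 2))) :=
    (hgi.const_mul _).add (hint2.const_mul _)
  calc ∫ y : EuclideanSpace ℝ (Fin 2), gaussWin L 0 y / (‖y‖ + ρ)
      ≤ ∫ y : EuclideanSpace ℝ (Fin 2), ((1 / R) * gaussWin L 0 y +
          (Real.exp 1 * ρ⁻¹) * (gaussWin L 0 y * Real.exp (-‖y‖ ^ 2 / R ^ 2))) :=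
        integral_mono hint hrhs hpt
    _ = (1 / R) * 1 + (Real.exp 1 * ρ⁻¹) * ∫ y : EuclideanSpace ℝ (Fin 2), gaussWin L 0 y * Real.exp (-‖y‖ ^ 2 / R ^ 2) := by
        rw [integral_add (hgi.const_mul _) (hint2.const_mul _), integral_const_mul, integral_const_mul,
          integral_gaussWin_zero hL]
    _ ≤ (1 / R) * 1 + (Real.exp 1 * ρ⁻¹) * (R ^ 2 / (4 * L ^ 2)) := by gcongr
    _ = 1 / R + Real.exp 1 * R ^ 2 / (4 * ρ * L ^ 2) := by field_simp

/-! ### The height derivative of the windowed flux -/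

section Kinematic

variable {V : EuclideanSpace ℝ (Fin 3) → EuclideanSpace ℝ (Fin 3)}

/-- **Height derivative of the windowed plane flux.**  For a `C²` field `V` with `‖D(curl V)‖ ≤ M₂` and bounded vorticity
`‖curl V‖ ≤ B₁`, the windowed flux `Ψ_L(c) = ∫ ⟪curl V(y,c), e₃⟫ g_{L,0}(y) dy` is differentiable in the height with
`Ψ_L′(c) = Σ_{j=0,1} ∫ (curl V(y,c))ⱼ ∂ⱼg_{L,0}(y) dy` (differentiate under the integral, `∂₃ω₃ = −∂₀ω₀ − ∂₁ω₁` by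
`div curl = 0`, and integrate by parts in the plane). -/
theorem hasDerivAt_windowedFlux_height (hV2 : ContDiff ℝ 2 V) {B₁ M₂ : ℝ} (hB₁ : ∀ x, ‖curl V x‖ ≤ B₁)
    (hM₂ : ∀ x, ‖fderiv ℝ (curl V) x‖ ≤ M₂) {L : ℝ} (hL : 0 < L) (c : ℝ) :
    HasDerivAt (fun c : ℝ => ∫ y, ⟪curl V (planePt c y), e3⟫ * gaussWin L 0 y)
      ((∫ y, curl V (planePt c y) 0 * fderiv ℝ (gaussWin L 0) y (EuclideanSpace.single 0 1)) +
        ∫ y, curl V (planePt c y) 1 * fderiv ℝ (gaussWin L 0) y (EuclideanSpace.single 1 1)) c := by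
  set W : EuclideanSpace ℝ (Fin 3) → EuclideanSpace ℝ (Fin 3) := curl V with hW
  have hW1 : ContDiff ℝ 1 W := contDiff_one_curl hV2
  have hWd : Differentiable ℝ W := hW1.differentiable one_ne_zero
  have hWc : Continuous W := hW1.continuous
  have hDWc : Continuous (fderiv ℝ W) := hW1.continuous_fderiv one_ne_zero
  have hM₂0 : 0 ≤ M₂ := (norm_nonneg _).trans (hM₂ 0)
  -- differentiation under the integral sign
  set F : ℝ → EuclideanSpace ℝ (Fin 2) → ℝ := fun c y => ⟪W (planePt c y), e3⟫ * gaussWin L 0 y with hF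
  set F' : ℝ → EuclideanSpace ℝ (Fin 2) → ℝ := fun c y => ⟪fderiv ℝ W (planePt c y) e3, e3⟫ * gaussWin L 0 y with hF'
  have hFc : ∀ c, Continuous (F c) := fun c =>
    ((hWc.comp (continuous_planePt c)).inner continuous_const).mul (continuous_gaussWin L 0)
  have hF'c : ∀ c, Continuous (F' c) := fun c =>
    (((hDWc.comp (continuous_planePt c)).clm_apply continuous_const).inner continuous_const).mul (continuous_gaussWin L 0)
  have hFint : Integrable (F c) := by
    refine Integrable.mono' ((integrable_gaussWin hL 0).const_mul B₁) (hFc c).aestronglyMeasurable (ae_of_all _ fun y => ?_)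
    simp only [hF]
    rw [norm_mul, Real.norm_eq_abs, Real.norm_eq_abs, abs_of_pos (gaussWin_pos hL 0 y)]
    exact mul_le_mul_of_nonneg_right ((abs_inner_e3_le _).trans (hB₁ _)) (gaussWin_pos hL 0 y).le
  have hbound : ∀ᵐ y ∂(volume : Measure (EuclideanSpace ℝ (Fin 2))), ∀ c' ∈ (univ : Set ℝ), ‖F' c' y‖ ≤ M₂ * gaussWin L 0 y := by
    refine ae_of_all _ fun y c' _ => ?_
    simp only [hF']
    rw [norm_mul, Real.norm_eq_abs, Real.norm_eq_abs, abs_of_pos (gaussWin_pos hL 0 y)]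
    refine mul_le_mul_of_nonneg_right ?_ (gaussWin_pos hL 0 y).le
    calc |⟪fderiv ℝ W (planePt c' y) e3, e3⟫| ≤ ‖fderiv ℝ W (planePt c' y) e3‖ := abs_inner_e3_le _
      _ ≤ ‖fderiv ℝ W (planePt c' y)‖ * ‖e3‖ := ContinuousLinearMap.le_opNorm _ _
      _ ≤ M₂ * 1 := by
          rw [show ‖e3‖ = 1 by rw [e3, PiLp.norm_single, norm_one]]
          exact mul_le_mul_of_nonneg_right (hM₂ _) zero_le_one
      _ = M₂ := mul_one _
  have hdiff : ∀ᵐ y ∂(volume : Measure (EuclideanSpace ℝ (Fin 2))), ∀ c' ∈ (univ : Set ℝ),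
      HasDerivAt (fun c => F c y) (F' c' y) c' := by
    refine ae_of_all _ fun y c' _ => ?_
    have h1 : HasDerivAt (fun c : ℝ => W (planePt c y)) (fderiv ℝ W (planePt c' y) e3) c' :=
      (hWd _).hasFDerivAt.comp_hasDerivAt c' (hasDerivAt_planePt_height c' y)
    have h2 : HasDerivAt (fun c : ℝ => ⟪W (planePt c y), e3⟫) ⟪fderiv ℝ W (planePt c' y) e3, e3⟫ c' := by
      have := h1.inner ℝ (hasDerivAt_const c' e3)
      simpa using this
    exact h2.mul_const _
  have hD := (hasDerivAt_integral_of_dominated_loc_of_deriv_le (μ := volume) (F := F) (F' := F') (x₀ := c)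
    (s := univ) univ_mem (Eventually.of_forall fun c' => (hFc c').aestronglyMeasurable) hFint
    (hF'c c).aestronglyMeasurable hbound ((integrable_gaussWin hL 0).const_mul M₂) hdiff).2
  -- rewrite the derivative: `⟪DW e₃, e₃⟫ = −∂₀W₀ − ∂₁W₁`, then integrate by parts in the plane
  have hcoord : ∀ y, ⟪fderiv ℝ W (planePt c y) e3, e3⟫ =
      -(fderiv ℝ (fun x => W x 0) (planePt c y) (EuclideanSpace.single (Fin.castSucc 0) 1)) -
        fderiv ℝ (fun x => W x 1) (planePt c y) (EuclideanSpace.single (Fin.castSucc 1) 1) := by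
    intro y
    have hdiv : VectorCalculus.divergence W (planePt c y) = 0 := divergence_curl_eq_zero_holds V hV2 _
    rw [divergence_eq_sum_three] at hdiv
    rw [inner_e3_eq_apply, e3, fderiv_coord_apply (hWd _) 0, fderiv_coord_apply (hWd _) 1]
    have e0 : (Fin.castSucc (0 : Fin 2) : Fin 3) = 0 := rfl
    have e1 : (Fin.castSucc (1 : Fin 2) : Fin 3) = 1 := rfl
    rw [e0, e1]
    linarith
  -- the in-plane integrations by parts (component functions are bounded `C¹` with bounded gradient)
  have hG : ∀ i : Fin 3, ContDiff ℝ 1 (fun x => W x i) := fun i =>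
    (EuclideanSpace.proj (𝕜 := ℝ) i).contDiff.comp hW1
  have hGb : ∀ (i : Fin 3) x, ‖W x i‖ ≤ B₁ := fun i x =>
    (PiLp.norm_apply_le (W x) i).trans (hB₁ x)
  have hGd : ∀ (i : Fin 3) x, ‖fderiv ℝ (fun x => W x i) x‖ ≤ M₂ := fun i x =>
    (norm_fderiv_coord_le_opNorm (hWd x) i).trans (hM₂ x)
  obtain ⟨hI0, hJ0, hibp0⟩ := integral_fderiv_planePt_mul_gaussWin (hG 0) (hGb 0) (hGd 0) hL c 0 0
  obtain ⟨hI1, hJ1, hibp1⟩ := integral_fderiv_planePt_mul_gaussWin (hG 1) (hGb 1) (hGd 1) hL c 0 1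
  have hval : ∫ y, F' c y =
      (∫ y, W (planePt c y) 0 * fderiv ℝ (gaussWin L 0) y (EuclideanSpace.single 0 1)) +
        ∫ y, W (planePt c y) 1 * fderiv ℝ (gaussWin L 0) y (EuclideanSpace.single 1 1) := by
    have hfun : (fun y => F' c y) = fun y =>
        -(fderiv ℝ (fun x => W x 0) (planePt c y) (EuclideanSpace.single (Fin.castSucc 0) 1) * gaussWin L 0 y) -
          fderiv ℝ (fun x => W x 1) (planePt c y) (EuclideanSpace.single (Fin.castSucc 1) 1) * gaussWin L 0 y := by
      funext y
      simp only [hF', hcoord y]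
      ring
    rw [hfun, integral_sub (by exact hI0.neg) hI1, integral_neg, hibp0, hibp1]
    ring
  rw [hval] at hD
  exact hD

/-- **The height derivative is small for wide windows under vorticity decay**: with `‖curl V(x)‖(‖x‖+ρ)² ≤ A`,
`|Σ_{j} ∫ (curl V(y,c))ⱼ ∂ⱼg_{L,0}(y) dy| ≤ (A/L²)·(1/R + eR²/(4ρL²))` for every `R > 0`. -/
theorem abs_windowedFlux_height_deriv_le {A ρ : ℝ} (hρ : 0 < ρ) (hA : ∀ x, ‖curl V x‖ * (‖x‖ + ρ) ^ 2 ≤ A)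
    {L : ℝ} (hL : 0 < L) {R : ℝ} (hR : 0 < R) (c : ℝ) :
    |(∫ y, curl V (planePt c y) 0 * fderiv ℝ (gaussWin L 0) y (EuclideanSpace.single 0 1)) +
        ∫ y, curl V (planePt c y) 1 * fderiv ℝ (gaussWin L 0) y (EuclideanSpace.single 1 1)| ≤
      A / L ^ 2 * (1 / R + Real.exp 1 * R ^ 2 / (4 * ρ * L ^ 2)) := by
  have hA0 : 0 ≤ A := le_trans (by positivity) (hA 0)
  obtain ⟨hJint, hJle⟩ := integral_gaussWin_div_le hL hR hρ
  -- pointwise: `|Wⱼ(y,c) ∂ⱼg(y)| ≤ (A/(2L²)) g(y)/(‖y‖+ρ)`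
  have hpt : ∀ (j : Fin 2) (y : EuclideanSpace ℝ (Fin 2)),
      ‖curl V (planePt c y) (Fin.castSucc j) * fderiv ℝ (gaussWin L 0) y (EuclideanSpace.single j 1)‖ ≤
        A / (2 * L ^ 2) * (gaussWin L 0 y / (‖y‖ + ρ)) := by
    intro j y
    rw [norm_mul, Real.norm_eq_abs, Real.norm_eq_abs]
    have h1 : |curl V (planePt c y) (Fin.castSucc j)| ≤ ‖curl V (planePt c y)‖ := by
      rw [← Real.norm_eq_abs]; exact PiLp.norm_apply_le _ _
    have h2 := abs_fderiv_gaussWin_zero_apply_le hL y (EuclideanSpace.single j 1)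
    rw [PiLp.norm_single, norm_one, mul_one] at h2
    have hg0 : 0 ≤ gaussWin L 0 y := (gaussWin_pos hL 0 y).le
    have hyρ : 0 < ‖y‖ + ρ := by positivity
    -- `‖W(x)‖ ‖y‖ (‖y‖+ρ) ≤ A`
    have h3 : ‖curl V (planePt c y)‖ * ‖y‖ ≤ A / (‖y‖ + ρ) := by
      rw [le_div_iff₀ hyρ]
      have hyx : ‖y‖ ≤ ‖planePt c y‖ + ρ := (norm_le_norm_planePt c y).trans (le_add_of_nonneg_right hρ.le)
      have hyx' : ‖y‖ + ρ ≤ ‖planePt c y‖ + ρ := by linarith [norm_le_norm_planePt c y]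
      calc ‖curl V (planePt c y)‖ * ‖y‖ * (‖y‖ + ρ)
          ≤ ‖curl V (planePt c y)‖ * (‖planePt c y‖ + ρ) * (‖planePt c y‖ + ρ) := by gcongr
        _ = ‖curl V (planePt c y)‖ * (‖planePt c y‖ + ρ) ^ 2 := by ring
        _ ≤ A := hA _
    calc |curl V (planePt c y) (Fin.castSucc j)| * |fderiv ℝ (gaussWin L 0) y (EuclideanSpace.single j 1)|
        ≤ ‖curl V (planePt c y)‖ * (gaussWin L 0 y * ‖y‖ / (2 * L ^ 2)) := mul_le_mul h1 h2 (abs_nonneg _) (norm_nonneg _)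
      _ = (‖curl V (planePt c y)‖ * ‖y‖) * gaussWin L 0 y / (2 * L ^ 2) := by ring
      _ ≤ (A / (‖y‖ + ρ)) * gaussWin L 0 y / (2 * L ^ 2) := by gcongr
      _ = A / (2 * L ^ 2) * (gaussWin L 0 y / (‖y‖ + ρ)) := by ring
  have hbd := hJint.const_mul (A / (2 * L ^ 2))
  have hterm : ∀ j : Fin 2,
      |∫ y, curl V (planePt c y) (Fin.castSucc j) * fderiv ℝ (gaussWin L 0) y (EuclideanSpace.single j 1)| ≤
        A / (2 * L ^ 2) * ∫ y : EuclideanSpace ℝ (Fin 2), gaussWin L 0 y / (‖y‖ + ρ) := by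
    intro j
    have h := norm_integral_le_of_norm_le hbd (ae_of_all _ (hpt j))
    rw [Real.norm_eq_abs, integral_const_mul] at h
    exact h
  have e0 : (Fin.castSucc (0 : Fin 2) : Fin 3) = 0 := rfl
  have e1 : (Fin.castSucc (1 : Fin 2) : Fin 3) = 1 := rfl
  have h0 := hterm 0
  have h1 := hterm 1
  rw [e0] at h0
  rw [e1] at h1
  calc |(∫ y, curl V (planePt c y) 0 * fderiv ℝ (gaussWin L 0) y (EuclideanSpace.single 0 1)) +
          ∫ y, curl V (planePt c y) 1 * fderiv ℝ (gaussWin L 0) y (EuclideanSpace.single 1 1)|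
      ≤ |∫ y, curl V (planePt c y) 0 * fderiv ℝ (gaussWin L 0) y (EuclideanSpace.single 0 1)| +
          |∫ y, curl V (planePt c y) 1 * fderiv ℝ (gaussWin L 0) y (EuclideanSpace.single 1 1)| := abs_add_le _ _
    _ ≤ A / (2 * L ^ 2) * (∫ y : EuclideanSpace ℝ (Fin 2), gaussWin L 0 y / (‖y‖ + ρ)) +
          A / (2 * L ^ 2) * ∫ y : EuclideanSpace ℝ (Fin 2), gaussWin L 0 y / (‖y‖ + ρ) := add_le_add h0 h1
    _ = A / L ^ 2 * ∫ y : EuclideanSpace ℝ (Fin 2), gaussWin L 0 y / (‖y‖ + ρ) := by ring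
    _ ≤ A / L ^ 2 * (1 / R + Real.exp 1 * R ^ 2 / (4 * ρ * L ^ 2)) := by gcongr

/-- **Lipschitz dependence of the scaled windowed flux on the height**: `|4πL²Ψ_L(c₂) − 4πL²Ψ_L(c₁)| ≤ 4πA (1/R + eR²/(4ρL²)) |c₂ − c₁|`
(mean value theorem with `hasDerivAt_windowedFlux_height` and `abs_windowedFlux_height_deriv_le`). -/
theorem abs_sub_windowedFlux_le (hV2 : ContDiff ℝ 2 V) {B₁ M₂ A ρ : ℝ} (hB₁ : ∀ x, ‖curl V x‖ ≤ B₁)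
    (hM₂ : ∀ x, ‖fderiv ℝ (curl V) x‖ ≤ M₂) (hρ : 0 < ρ) (hA : ∀ x, ‖curl V x‖ * (‖x‖ + ρ) ^ 2 ≤ A)
    {L : ℝ} (hL : 0 < L) {R : ℝ} (hR : 0 < R) (c₁ c₂ : ℝ) :
    |4 * Real.pi * L ^ 2 * (∫ y, ⟪curl V (planePt c₂ y), e3⟫ * gaussWin L 0 y) -
        4 * Real.pi * L ^ 2 * (∫ y, ⟪curl V (planePt c₁ y), e3⟫ * gaussWin L 0 y)| ≤
      4 * Real.pi * A * (1 / R + Real.exp 1 * R ^ 2 / (4 * ρ * L ^ 2)) * |c₂ - c₁| := by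
  have hmvt := Convex.norm_image_sub_le_of_norm_hasDerivWithin_le
    (f := fun c : ℝ => ∫ y, ⟪curl V (planePt c y), e3⟫ * gaussWin L 0 y)
    (fun c _ => (hasDerivAt_windowedFlux_height hV2 hB₁ hM₂ hL c).hasDerivWithinAt)
    (fun c _ => by
      rw [Real.norm_eq_abs]
      exact abs_windowedFlux_height_deriv_le hρ hA hL hR c)
    convex_univ (mem_univ c₁) (mem_univ c₂)
  rw [Real.norm_eq_abs, Real.norm_eq_abs] at hmvt
  have hL2 : 0 < 4 * Real.pi * L ^ 2 := by positivity
  rw [← mul_sub, abs_mul, abs_of_pos hL2]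
  calc 4 * Real.pi * L ^ 2 * |(∫ y, ⟪curl V (planePt c₂ y), e3⟫ * gaussWin L 0 y) -
          ∫ y, ⟪curl V (planePt c₁ y), e3⟫ * gaussWin L 0 y|
      ≤ 4 * Real.pi * L ^ 2 * (A / L ^ 2 * (1 / R + Real.exp 1 * R ^ 2 / (4 * ρ * L ^ 2)) * |c₂ - c₁|) :=
        mul_le_mul_of_nonneg_left hmvt hL2.le
    _ = 4 * Real.pi * A * (1 / R + Real.exp 1 * R ^ 2 / (4 * ρ * L ^ 2)) * |c₂ - c₁| := by
        field_simp

end Kinematic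

end Summit.NavierStokesRegularity.NavierStokesRegularity.Theorems.HalfSpaceWindowDoorCirculationCarryingRigidityPlaneFluxHeightWindow

end
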